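import Summits.AtomisticToContinuum.BoseEinsteinCondensation.Theorems.BECThomsonPrincipleGDTransferSeededDefs

/-!
# Route `BECThomsonPrinciple`, crux `GDTransfer` (stmt-AtomisticToContinuum-9482), line `seeded-continuity`:
# registered stub `stub_ivtGlue` — the connectedness assembly

Supports (does not close) stmt-AtomisticToContinuum-9482.  Proves the registered stub `stub_ivtGlue : Sig.stub_ivtGlue`
of the line's Defs module: `CountLaw → NoBalancedCat → ∀ v adm, BandEmptiness v → FreeCorner v → LocalConstancy v →
PeriodicBECFor v` — the physics-free step of the line.  Given (i) that the crux's `Q_S`-masses of a periodic trial state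
form a probability law with mean `condensateOccupation`, (ii) the SEED (near-minimisers are never balanced macroscopic
superpositions of a depleted and a condensed branch), (iii) band emptiness at near-minimisers uniformly down the density
scale (the output of Gaussian domination), (iv) the free corner and (v) local constancy of the condensed-side mass of
near-minimisers in the side `L`, condensation of the near-minimisers at side `L_N = (N/ρ)^{1/3}` follows by CONNECTEDNESS
of the path of sides `[L_N, max L_N (A·N)]` (template: `CorrectorClosure.VolumeHomotopySumRuleDomination.stub_volumeBootstrap`).
§B1: law bookkeeping from `CountLaw` (1) (`lo + band + hi = 1`, the one-state dichotomy, mean versus condensed-side mass,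
existence of near-minimisers); §B2: the assembly.  References: LSSY2005 §1.2 (1.17)–(1.19); KennedyLiebShastry1988.
-/

noncomputable section

open MeasureTheory Filter Set Metric
open scoped ENNReal NNReal

namespace Summit.AtomisticToContinuum.BoseEinsteinCondensation.Cruxes.GDTransfer.Seeded

open Literature.MathematicalPhysics.QuantumManyBody.BoseGas
open Summit.AtomisticToContinuum.BoseEinsteinCondensation.Theses.BECThomsonPrinciple
open Summit.AtomisticToContinuum.BoseEinsteinCondensation.Theorems.GaussianDominationCan.Negative (modeProj cellAvg)
open Summit.AtomisticToContinuum.BoseEinsteinCondensation.Cruxes.GDTransfer.DysonDressedWitness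
  (PeriodicBECFor gdTransfer_iff)

/-! ## (B1) Law bookkeeping (from `CountLaw` (1)) -/

section Law

variable {m : ℕ} {L : ℝ}

/-- A law mass is a partial sum of the component masses. -/
theorem lawMass_le_sum (m : ℕ) (L : ℝ) (p : ℕ → Prop) [DecidablePred p] (ψ : Config (m + 1) → ℂ) :
    lawMass m L p ψ ≤ ∑ S : Finset (Fin (m + 1)), compMass m L S ψ :=
  Finset.sum_le_sum_of_subset_of_nonneg (Finset.filter_subset _ _) fun _ _ _ => bot_le

/-- Complementary law masses add up to the total mass. -/
theorem lawMass_add_lawMass_not (m : ℕ) (L : ℝ) (p : ℕ → Prop) [DecidablePred p]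
    (ψ : Config (m + 1) → ℂ) :
    lawMass m L p ψ + lawMass m L (fun j => ¬ p j) ψ = ∑ S : Finset (Fin (m + 1)), compMass m L S ψ := by
  unfold lawMass
  exact Finset.sum_filter_add_sum_filter_not _ _ _

/-- Under `CountLaw` every law mass of a periodic trial state is at most `1`. -/
theorem lawMass_le_one (hC : CountLaw) (hL : 0 < L) (Ψ : PeriodicTrialState (m + 1) L) (p : ℕ → Prop)
    [DecidablePred p] : lawMass m L p Ψ.ψ ≤ 1 := by
  rw [← (hC.1 m L hL Ψ).1]
  exact lawMass_le_sum m L p Ψ.ψ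

/-- Hence it is finite. -/
theorem lawMass_ne_top (hC : CountLaw) (hL : 0 < L) (Ψ : PeriodicTrialState (m + 1) L) (p : ℕ → Prop)
    [DecidablePred p] : lawMass m L p Ψ.ψ ≠ ⊤ :=
  ne_top_of_le_ne_top ENNReal.one_ne_top (lawMass_le_one hC hL Ψ p)

/-- The complement of the condensed side has mass `1 − hiMass` (real form). -/
theorem lawMass_not_hi_toReal (hC : CountLaw) (hL : 0 < L) (Ψ : PeriodicTrialState (m + 1) L) (β : ℝ) :
    (lawMass m L (fun j => ¬ ((1 - β) * (m + 1) ≤ (j : ℝ))) Ψ.ψ).toReal =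
      1 - (hiMass m L β Ψ.ψ).toReal := by
  have h := lawMass_add_lawMass_not m L (fun j => (1 - β) * (m + 1) ≤ (j : ℝ)) Ψ.ψ
  rw [(hC.1 m L hL Ψ).1] at h
  have h2 := congrArg ENNReal.toReal h
  rw [ENNReal.toReal_add (lawMass_ne_top hC hL Ψ _) (lawMass_ne_top hC hL Ψ _), ENNReal.toReal_one] at h2
  unfold hiMass
  linarith

/-- **The three sides exhaust the law**: `lo + band + hi = 1` for `θN ≤ (1−β)N`. -/
theorem lo_add_band_add_hi (hC : CountLaw) (hL : 0 < L) (Ψ : PeriodicTrialState (m + 1) L) {θ β : ℝ}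
    (hθβ : θ * (m + 1) ≤ (1 - β) * (m + 1)) :
    loMass m L θ Ψ.ψ + bandMass m L θ β Ψ.ψ + hiMass m L β Ψ.ψ = 1 := by
  classical
  have h1 := lawMass_add_lawMass_not m L (fun j => (j : ℝ) < θ * (m + 1)) Ψ.ψ
  have h2 : lawMass m L (fun j => ¬ ((j : ℝ) < θ * (m + 1))) Ψ.ψ =
      bandMass m L θ β Ψ.ψ + hiMass m L β Ψ.ψ := by
    unfold bandMass hiMass lawMass
    rw [← Finset.sum_filter_add_sum_filter_not
      (Finset.univ.filter fun S : Finset (Fin (m + 1)) => ¬ ((S.card : ℝ) < θ * (m + 1)))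
      (fun S => (S.card : ℝ) < (1 - β) * (m + 1)), Finset.filter_filter, Finset.filter_filter]
    congr 1
    · refine Finset.sum_congr (Finset.filter_congr fun S _ => ?_) fun _ _ => rfl
      rw [not_lt]
    · refine Finset.sum_congr (Finset.filter_congr fun S _ => ?_) fun _ _ => rfl
      rw [not_lt, not_lt]
      exact ⟨fun h => h.2, fun h => ⟨hθβ.trans h, h⟩⟩
  rw [(hC.1 m L hL Ψ).1, h2, ← add_assoc] at h1
  exact h1

/-- Real form of `lo + band + hi = 1`. -/
theorem lo_add_band_add_hi_toReal (hC : CountLaw) (hL : 0 < L) (Ψ : PeriodicTrialState (m + 1) L) {θ β : ℝ}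
    (hθβ : θ * (m + 1) ≤ (1 - β) * (m + 1)) :
    (loMass m L θ Ψ.ψ).toReal + (bandMass m L θ β Ψ.ψ).toReal + (hiMass m L β Ψ.ψ).toReal = 1 := by
  classical
  have hlo : loMass m L θ Ψ.ψ ≠ ⊤ := lawMass_ne_top hC hL Ψ _
  have hband : bandMass m L θ β Ψ.ψ ≠ ⊤ := lawMass_ne_top hC hL Ψ _
  have hhi : hiMass m L β Ψ.ψ ≠ ⊤ := lawMass_ne_top hC hL Ψ _
  have h := congrArg ENNReal.toReal (lo_add_band_add_hi hC hL Ψ hθβ)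
  rwa [ENNReal.toReal_add (ENNReal.add_ne_top.2 ⟨hlo, hband⟩) hhi, ENNReal.toReal_add hlo hband,
    ENNReal.toReal_one] at h

/-- **The dichotomy at one state**: if the seed's negation holds at `Ψ` (not both sides carry mass `≥ τ`) and the
band carries at most `η`, then the condensed side is either below `τ` or above `1 − τ − η`. -/
theorem hi_dichotomy (hC : CountLaw) (hL : 0 < L) (Ψ : PeriodicTrialState (m + 1) L) {θ β τ η : ℝ}
    (hθβ : θ * (m + 1) ≤ (1 - β) * (m + 1)) (hη : 0 ≤ η)
    (hseed : ¬ (ENNReal.ofReal τ ≤ loMass m L θ Ψ.ψ ∧ ENNReal.ofReal τ ≤ hiMass m L β Ψ.ψ))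
    (hband : bandMass m L θ β Ψ.ψ ≤ ENNReal.ofReal η) :
    (hiMass m L β Ψ.ψ).toReal < τ ∨ 1 - τ - η < (hiMass m L β Ψ.ψ).toReal := by
  have hsum := lo_add_band_add_hi_toReal hC hL Ψ hθβ
  have hb : (bandMass m L θ β Ψ.ψ).toReal ≤ η := ENNReal.toReal_le_of_le_ofReal hη hband
  by_cases h : ENNReal.ofReal τ ≤ hiMass m L β Ψ.ψ
  · have hlo : loMass m L θ Ψ.ψ < ENNReal.ofReal τ := not_le.mp fun h' => hseed ⟨h', h⟩
    have hlo' : (loMass m L θ Ψ.ψ).toReal < τ := ENNReal.toReal_lt_of_lt_ofReal hlo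
    right
    linarith
  · left
    exact ENNReal.toReal_lt_of_lt_ofReal (not_le.mp h)

/-- **Mean versus condensed-side mass, upper form**: `⟨n̂₀⟩ + βN·P(n̂₀ < (1−β)N) ≤ N`. -/
theorem mean_add_le (hC : CountLaw) (hL : 0 < L) (Ψ : PeriodicTrialState (m + 1) L) {β : ℝ} (hβ : 0 ≤ β) :
    condensateOccupation (m + 1) L Ψ.ψ +
        ENNReal.ofReal (β * (m + 1)) * lawMass m L (fun j => ¬ ((1 - β) * (m + 1) ≤ (j : ℝ))) Ψ.ψ ≤
      ((m + 1 : ℕ) : ℝ≥0∞) := by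
  classical
  obtain ⟨hsum, hmean⟩ := hC.1 m L hL Ψ
  set w : Finset (Fin (m + 1)) → ℝ≥0∞ := fun S => compMass m L S Ψ.ψ with hw
  set p : Finset (Fin (m + 1)) → Prop := fun S => (1 - β) * (m + 1) ≤ (S.card : ℝ) with hp
  have hsplit := Finset.sum_filter_add_sum_filter_not (Finset.univ : Finset (Finset (Fin (m + 1)))) p
    (fun S => (S.card : ℝ≥0∞) * w S)
  have htot : ((m + 1 : ℕ) : ℝ≥0∞) = ∑ S : Finset (Fin (m + 1)), ((m + 1 : ℕ) : ℝ≥0∞) * w S := by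
    rw [← Finset.mul_sum, hsum, mul_one]
  have htot' := Finset.sum_filter_add_sum_filter_not (Finset.univ : Finset (Finset (Fin (m + 1)))) p
    (fun S => ((m + 1 : ℕ) : ℝ≥0∞) * w S)
  rw [← hmean, ← hsplit, htot, ← htot', add_assoc]
  unfold lawMass
  rw [Finset.mul_sum, ← Finset.sum_add_distrib]
  refine add_le_add (Finset.sum_le_sum fun S _ => ?_) (Finset.sum_le_sum fun S hS => ?_)
  · gcongr
    exact_mod_cast (Finset.card_le_univ S).trans_eq (Fintype.card_fin _)
  · rw [← add_mul]
    gcongr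
    have hS' : (S.card : ℝ) < (1 - β) * (m + 1) := not_le.mp (Finset.mem_filter.1 hS).2
    have h1 : (S.card : ℝ≥0∞) = ENNReal.ofReal (S.card : ℝ) := by rw [ENNReal.ofReal_natCast]
    rw [h1, ← ENNReal.ofReal_add (Nat.cast_nonneg _) (by positivity),
      show ((m + 1 : ℕ) : ℝ≥0∞) = ENNReal.ofReal ((m + 1 : ℕ) : ℝ) by rw [ENNReal.ofReal_natCast]]
    refine ENNReal.ofReal_le_ofReal ?_
    push_cast
    nlinarith

/-- **Mean versus condensed-side mass, lower form**: `(1−β)N · P(n̂₀ ≥ (1−β)N) ≤ ⟨n̂₀⟩`. -/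
theorem hi_mul_le_mean (hC : CountLaw) (hL : 0 < L) (Ψ : PeriodicTrialState (m + 1) L) (β : ℝ) :
    ENNReal.ofReal ((1 - β) * (m + 1)) * hiMass m L β Ψ.ψ ≤ condensateOccupation (m + 1) L Ψ.ψ := by
  classical
  obtain ⟨-, hmean⟩ := hC.1 m L hL Ψ
  rw [← hmean]
  unfold hiMass lawMass
  rw [Finset.mul_sum]
  refine (Finset.sum_le_sum fun S hS => ?_).trans
    (Finset.sum_le_sum_of_subset_of_nonneg (Finset.filter_subset _ _) fun _ _ _ => bot_le)
  gcongr
  have hS' : (1 - β) * (m + 1) ≤ (S.card : ℝ) := (Finset.mem_filter.1 hS).2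
  rw [show (S.card : ℝ≥0∞) = ENNReal.ofReal (S.card : ℝ) by rw [ENNReal.ofReal_natCast]]
  exact ENNReal.ofReal_le_ofReal hS'

/-- Near-minimisers with any positive slack exist as soon as the ground-state energy is finite. -/
theorem exists_nearMin {v : ℝ → ℝ≥0∞} (hE : periodicGroundStateEnergy v (m + 1) L ≠ ⊤) {δ : ℝ≥0∞}
    (hδ : 0 < δ) : ∃ Ψ : PeriodicTrialState (m + 1) L,
      periodicEnergy v Ψ ≤ periodicGroundStateEnergy v (m + 1) L + δ := by
  have hlt := ENNReal.lt_add_right hE hδ.ne'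
  unfold periodicGroundStateEnergy at hlt ⊢
  obtain ⟨Ψ, hΨ⟩ := iInf_lt_iff.mp hlt
  exact ⟨Ψ, hΨ.le⟩

end Law

/-! ## (B) Stub `stub_ivtGlue` -/

/-- **Registered stub `stub_ivtGlue`** (line `seeded-continuity` of crux `GDTransfer`, stmt-AtomisticToContinuum-9482):
the connectedness assembly.  Constants `θ = β = 1/8 → (τ, ρ₀ˢ, N₀ˢ)` (seed) `→ η = (1−2τ)/4 →` band emptiness
`(ε := η) →` corner `(ε := (τ+η)/16)`; `ρ₀ := min ρ₀ˢ ρ₀ᵇ`, `c := (7/8)(1−τ−η)/2`.  For `ρ < ρ₀` and large `N`, on the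
path of sides `[L_N, max L_N (A·N)]` (`L_N = sideLength ρ N`) every side is `good` (all small-slack near-minimisers have
`hiMass > 1−τ−η`) or `bad` (`hiMass < τ`) — dichotomy from `CountLaw` (1), band emptiness and the seed, one-sidedness from
`LocalConstancy` at `L' = L`; `good ↔ good` on small balls (`LocalConstancy`), the top side is good (free corner +
`mean_add_le`), so by `isPreconnected_Icc` the bottom side `L_N` is good, and `hi_mul_le_mean` gives `⟨n̂₀⟩ ≥ cN`. -/
theorem stub_ivtGlue : Sig.stub_ivtGlue := by
  intro hC hSeed v hv hBand hCorner hLoc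
  -- (1) constants from the seed (`θ = β = 1/8`)
  obtain ⟨τ, hτ0, hτ2, ρs, hρs, Ns, hseed⟩ :=
    (noBalancedCat_iff.mp hSeed) v hv (1 / 8) (1 / 8) (by norm_num) (by norm_num) (by norm_num)
  set η : ℝ := (1 - 2 * τ) / 4 with hηdef
  have hη0 : 0 < η := by rw [hηdef]; linarith
  set τ₂ : ℝ := 1 - τ - η with hτ₂def
  have hττ₂ : τ < τ₂ := by rw [hτ₂def, hηdef]; linarith
  have hτ₂0 : 0 < τ₂ := hτ0.trans hττ₂
  set γ : ℝ := (τ₂ - τ) / 2 with hγdef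
  have hγ0 : 0 < γ := by rw [hγdef]; linarith
  have hθβ : ∀ m : ℕ, (1 / 8 : ℝ) * (m + 1) ≤ (1 - 1 / 8) * (m + 1) := fun m => by
    have : (0 : ℝ) ≤ (m : ℝ) + 1 := by positivity
    nlinarith
  -- (2) band emptiness with `ε := η`
  obtain ⟨ρb, hρb, Nb, hband⟩ := hBand (1 / 8) (1 / 8) (by norm_num) (by norm_num) (by norm_num) η hη0
  -- (3) the corner with `ε := (τ + η)/16`
  set εc : ℝ := (τ + η) / 16 with hεcdef
  have hεc0 : 0 < εc := by positivity
  obtain ⟨A, hA, Nc, hcorner⟩ := hCorner εc hεc0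
  -- (4) the answer: `ρ₀ := min ρs ρb`, `c := (7/8) τ₂ / 2`
  refine ⟨min ρs ρb, lt_min hρs hρb, fun ρ hρ hρ0 => ?_⟩
  have hρs' : ρ < ρs := hρ0.trans_le (min_le_left _ _)
  have hρb' : ρ < ρb := hρ0.trans_le (min_le_right _ _)
  refine ⟨(7 / 8) * τ₂ / 2, by positivity, ?_⟩
  filter_upwards [eventually_ge_atTop Ns, eventually_ge_atTop Nb, eventually_ge_atTop Nc,
    eventually_ge_atTop 1] with N hNs hNb hNc hN1
  obtain ⟨m, rfl⟩ : ∃ m, N = m + 1 := ⟨N - 1, by omega⟩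
  -- (5) the path of sides `[L₀, Lt]`
  have hNr : (0 : ℝ) < ((m + 1 : ℕ) : ℝ) := Nat.cast_pos.2 (Nat.succ_pos m)
  set L₀ : ℝ := sideLength ρ (m + 1) with hL₀def
  have hL₀ : 0 < L₀ := Real.rpow_pos_of_pos (div_pos hNr hρ) _
  have hL₀3 : ρ * L₀ ^ 3 = ((m + 1 : ℕ) : ℝ) := by
    rw [hL₀def, sideLength_pow_three hρ (m + 1)]
    field_simp
  set Lt : ℝ := max L₀ (A * (m + 1)) with hLtdef
  have hL₀Lt : L₀ ≤ Lt := le_max_left _ _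
  have hpath : ∀ L : ℝ, L₀ ≤ L →
      0 < L ∧ ((m + 1 : ℕ) : ℝ) ≤ ρs * L ^ 3 ∧ ((m + 1 : ℕ) : ℝ) ≤ ρb * L ^ 3 := by
    intro L hL
    have hLpos : 0 < L := hL₀.trans_le hL
    have h3 : L₀ ^ 3 ≤ L ^ 3 := pow_le_pow_left₀ hL₀.le hL 3
    have hρL : ((m + 1 : ℕ) : ℝ) ≤ ρ * L ^ 3 := by rw [← hL₀3]; gcongr
    exact ⟨hLpos, hρL.trans (by gcongr), hρL.trans (by gcongr)⟩
  -- (6) `good` / `bad` sides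
  set good : ℝ → Prop := fun L => ∃ δ : ℝ≥0∞, 0 < δ ∧ ∀ Ψ : PeriodicTrialState (m + 1) L,
    periodicEnergy v Ψ ≤ periodicGroundStateEnergy v (m + 1) L + δ →
      τ₂ < (hiMass m L (1 / 8) Ψ.ψ).toReal with hgood
  set bad : ℝ → Prop := fun L => ∃ δ : ℝ≥0∞, 0 < δ ∧ ∀ Ψ : PeriodicTrialState (m + 1) L,
    periodicEnergy v Ψ ≤ periodicGroundStateEnergy v (m + 1) L + δ →
      (hiMass m L (1 / 8) Ψ.ψ).toReal < τ with hbad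
  -- (F1) every side of the path is good or bad
  have hdich : ∀ L : ℝ, L₀ ≤ L → good L ∨ bad L := by
    intro L hL
    obtain ⟨hLpos, hNs', hNb'⟩ := hpath L hL
    have hE : periodicGroundStateEnergy v (m + 1) L ≠ ⊤ := (hLoc m (1 / 8) L hLpos).1
    obtain ⟨δs, hδs, hS⟩ := hseed m hNs L hLpos hNs' hE
    obtain ⟨δb, hδb, hB⟩ := hband m hNb L hLpos hNb'
    obtain ⟨r, hr, δ₁, hδ₁, hloc⟩ := (hLoc m (1 / 8) L hLpos).2 γ hγ0
    obtain ⟨δ', hδ', hloc'⟩ := hloc L (by rw [sub_self, abs_zero]; exact hr)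
    set δ : ℝ≥0∞ := min (min δs δb) (min δ₁ δ') with hδdef
    have hδ : 0 < δ := lt_min (lt_min hδs hδb) (lt_min hδ₁ hδ')
    have hδ_s : δ ≤ δs := (min_le_left _ _).trans (min_le_left _ _)
    have hδ_b : δ ≤ δb := (min_le_left _ _).trans (min_le_right _ _)
    have hδ_1 : δ ≤ δ₁ := (min_le_right _ _).trans (min_le_left _ _)
    have hδ_' : δ ≤ δ' := (min_le_right _ _).trans (min_le_right _ _)
    have hD : ∀ Ψ : PeriodicTrialState (m + 1) L,
        periodicEnergy v Ψ ≤ periodicGroundStateEnergy v (m + 1) L + δ →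
        (hiMass m L (1 / 8) Ψ.ψ).toReal < τ ∨ τ₂ < (hiMass m L (1 / 8) Ψ.ψ).toReal := fun Ψ hΨ =>
      hi_dichotomy hC hLpos Ψ (hθβ m) hη0.le (hS Ψ (hΨ.trans (add_le_add le_rfl hδ_s)))
        (hB Ψ (hΨ.trans (add_le_add le_rfl hδ_b)))
    have hcl : ∀ Ψ Φ : PeriodicTrialState (m + 1) L,
        periodicEnergy v Ψ ≤ periodicGroundStateEnergy v (m + 1) L + δ →
        periodicEnergy v Φ ≤ periodicGroundStateEnergy v (m + 1) L + δ →
        (hiMass m L (1 / 8) Ψ.ψ).toReal ≤ (hiMass m L (1 / 8) Φ.ψ).toReal + γ := fun Ψ Φ hΨ hΦ =>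
      (hloc' Ψ Φ (hΨ.trans (add_le_add le_rfl hδ_')) (hΦ.trans (add_le_add le_rfl hδ_1))).1
    obtain ⟨Ψ₀, hΨ₀⟩ := exists_nearMin hE hδ
    rcases hD Ψ₀ hΨ₀ with h0 | h0
    · refine Or.inr ⟨δ, hδ, fun Ψ hΨ => ?_⟩
      rcases hD Ψ hΨ with h1 | h1
      · exact h1
      · have h2 := hcl Ψ Ψ₀ hΨ hΨ₀
        exact absurd h2 (by rw [hγdef]; linarith)
    · refine Or.inl ⟨δ, hδ, fun Ψ hΨ => ?_⟩
      rcases hD Ψ hΨ with h1 | h1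
      · have h2 := hcl Ψ₀ Ψ hΨ₀ hΨ
        exact absurd h2 (by rw [hγdef]; linarith)
      · exact h1
  -- (F2) no side is both
  have hexcl : ∀ L : ℝ, L₀ ≤ L → ¬ (good L ∧ bad L) := by
    rintro L hL ⟨⟨δg, hδg, hG⟩, ⟨δb', hδb', hBd⟩⟩
    obtain ⟨hLpos, -, -⟩ := hpath L hL
    have hE : periodicGroundStateEnergy v (m + 1) L ≠ ⊤ := (hLoc m (1 / 8) L hLpos).1
    obtain ⟨Ψ, hΨ⟩ := exists_nearMin hE (lt_min hδg hδb')
    linarith [hG Ψ (hΨ.trans (add_le_add le_rfl (min_le_left _ _))),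
      hBd Ψ (hΨ.trans (add_le_add le_rfl (min_le_right _ _)))]
  -- (F3) `good` is locally constant along the path
  have hlc : ∀ L₁ : ℝ, L₁ ∈ Icc L₀ Lt → ∃ r : ℝ, 0 < r ∧ ∀ L' : ℝ, L' ∈ Icc L₀ Lt →
      |L' - L₁| < r → (good L' ↔ good L₁) := by
    intro L₁ hL₁
    obtain ⟨hL₁pos, -, -⟩ := hpath L₁ hL₁.1
    have hE₁ : periodicGroundStateEnergy v (m + 1) L₁ ≠ ⊤ := (hLoc m (1 / 8) L₁ hL₁pos).1
    obtain ⟨r, hr, δ₁, hδ₁, hloc⟩ := (hLoc m (1 / 8) L₁ hL₁pos).2 γ hγ0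
    refine ⟨r, hr, fun L' hL' hdist => ?_⟩
    obtain ⟨hL'pos, -, -⟩ := hpath L' hL'.1
    have hE' : periodicGroundStateEnergy v (m + 1) L' ≠ ⊤ := (hLoc m (1 / 8) L' hL'pos).1
    obtain ⟨δ', hδ', hloc'⟩ := hloc L' hdist
    constructor
    · intro hgL'
      rcases hdich L₁ hL₁.1 with hg1 | hb1
      · exact hg1
      · exfalso
        obtain ⟨δg, hδg, hG⟩ := hgL'
        obtain ⟨δb1, hδb1, hBd⟩ := hb1
        obtain ⟨Ψ', hΨ'⟩ := exists_nearMin hE' (lt_min hδ' hδg)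
        obtain ⟨Ψ₁, hΨ₁⟩ := exists_nearMin hE₁ (lt_min hδ₁ hδb1)
        have hc := (hloc' Ψ' Ψ₁ (hΨ'.trans (add_le_add le_rfl (min_le_left _ _)))
          (hΨ₁.trans (add_le_add le_rfl (min_le_left _ _)))).1
        have h1 := hG Ψ' (hΨ'.trans (add_le_add le_rfl (min_le_right _ _)))
        have h2 := hBd Ψ₁ (hΨ₁.trans (add_le_add le_rfl (min_le_right _ _)))
        rw [hγdef] at hc
        linarith
    · intro hg1
      rcases hdich L' hL'.1 with hgL' | hbL'
      · exact hgL'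
      · exfalso
        obtain ⟨δg, hδg, hG⟩ := hg1
        obtain ⟨δb2, hδb2, hBd⟩ := hbL'
        obtain ⟨Ψ', hΨ'⟩ := exists_nearMin hE' (lt_min hδ' hδb2)
        obtain ⟨Ψ₁, hΨ₁⟩ := exists_nearMin hE₁ (lt_min hδ₁ hδg)
        have hc := (hloc' Ψ' Ψ₁ (hΨ'.trans (add_le_add le_rfl (min_le_left _ _)))
          (hΨ₁.trans (add_le_add le_rfl (min_le_left _ _)))).2
        have h1 := hG Ψ₁ (hΨ₁.trans (add_le_add le_rfl (min_le_right _ _)))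
        have h2 := hBd Ψ' (hΨ'.trans (add_le_add le_rfl (min_le_right _ _)))
        rw [hγdef] at hc
        linarith
  -- (F4) the top side is good (free corner)
  have hgoodtop : good Lt := by
    obtain ⟨hLtpos, -, -⟩ := hpath Lt hL₀Lt
    obtain ⟨δc, hδc, hcΨ⟩ := hcorner m hNc Lt (le_max_right _ _)
    refine ⟨δc, hδc, fun Ψ hΨ => ?_⟩
    have hmean := mean_add_le hC hLtpos Ψ (by norm_num : (0 : ℝ) ≤ 1 / 8)
    have hcor := hcΨ Ψ hΨ
    -- `N/8 · rest ≤ εc N`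
    have hn0top : condensateOccupation (m + 1) Lt Ψ.ψ ≠ ⊤ :=
      ne_top_of_le_ne_top (ENNReal.natCast_ne_top (m + 1)) (le_self_add.trans hmean)
    have hrest := ENNReal.le_of_add_le_add_left hn0top (hmean.trans hcor)
    have hrest_top : lawMass m Lt (fun j => ¬ ((1 - 1 / 8) * (m + 1) ≤ (j : ℝ))) Ψ.ψ ≠ ⊤ :=
      lawMass_ne_top hC hLtpos Ψ _
    have hreal := ENNReal.toReal_mono ENNReal.ofReal_ne_top hrest
    rw [ENNReal.toReal_mul, ENNReal.toReal_ofReal (by positivity), ENNReal.toReal_ofReal (by positivity),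
      lawMass_not_hi_toReal hC hLtpos Ψ (1 / 8)] at hreal
    -- `hreal : 1/8 (m+1) (1 − hi') ≤ εc (m+1)`
    have hm0 : (0 : ℝ) < (m : ℝ) + 1 := by positivity
    have h1 : 1 - (hiMass m Lt (1 / 8) Ψ.ψ).toReal ≤ 8 * εc := by
      by_contra hcon
      rw [not_le] at hcon
      have : εc * ((m : ℝ) + 1) < 1 / 8 * ((m : ℝ) + 1) * (1 - (hiMass m Lt (1 / 8) Ψ.ψ).toReal) := by
        nlinarith
      linarith
    rw [hεcdef] at h1
    rw [hτ₂def]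
    linarith
  -- (F5) the bottom side is good: connectedness of `[L₀, Lt]`
  have hgood0 : good L₀ := by
    by_contra hbad0
    choose! r hr0 hr using hlc
    set U : Set ℝ := ⋃ L' ∈ {L' : ℝ | L' ∈ Icc L₀ Lt ∧ good L'}, ball L' (r L') with hU
    set V : Set ℝ := ⋃ L' ∈ {L' : ℝ | L' ∈ Icc L₀ Lt ∧ ¬ good L'}, ball L' (r L') with hV
    have hUo : IsOpen U := isOpen_biUnion fun _ _ => isOpen_ball
    have hVo : IsOpen V := isOpen_biUnion fun _ _ => isOpen_ball
    have hcover : Icc L₀ Lt ⊆ U ∪ V := by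
      intro L' hL'
      by_cases hg : good L'
      · exact Or.inl (mem_biUnion (show L' ∈ {L' : ℝ | L' ∈ Icc L₀ Lt ∧ good L'} from ⟨hL', hg⟩)
          (mem_ball_self (hr0 L' hL')))
      · exact Or.inr (mem_biUnion (show L' ∈ {L' : ℝ | L' ∈ Icc L₀ Lt ∧ ¬ good L'} from ⟨hL', hg⟩)
          (mem_ball_self (hr0 L' hL')))
    have hLtP : Lt ∈ Icc L₀ Lt := ⟨hL₀Lt, le_rfl⟩
    have hL₀P : L₀ ∈ Icc L₀ Lt := ⟨le_rfl, hL₀Lt⟩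
    have hUne : (Icc L₀ Lt ∩ U).Nonempty :=
      ⟨Lt, hLtP, mem_biUnion (show Lt ∈ {L' : ℝ | L' ∈ Icc L₀ Lt ∧ good L'} from ⟨hLtP, hgoodtop⟩)
        (mem_ball_self (hr0 Lt hLtP))⟩
    have hVne : (Icc L₀ Lt ∩ V).Nonempty :=
      ⟨L₀, hL₀P, mem_biUnion (show L₀ ∈ {L' : ℝ | L' ∈ Icc L₀ Lt ∧ ¬ good L'} from ⟨hL₀P, hbad0⟩)
        (mem_ball_self (hr0 L₀ hL₀P))⟩
    obtain ⟨L'', hL''P, hL''U, hL''V⟩ := isPreconnected_Icc U V hUo hVo hcover hUne hVne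
    rw [hU, mem_iUnion₂] at hL''U
    rw [hV, mem_iUnion₂] at hL''V
    obtain ⟨La, ⟨hLaP, hLa⟩, haL⟩ := hL''U
    obtain ⟨Lb, ⟨hLbP, hLb⟩, hbL⟩ := hL''V
    rw [mem_ball, Real.dist_eq] at haL hbL
    have h1 : good L'' := (hr La hLaP L'' hL''P haL).mpr hLa
    exact hLb ((hr Lb hLbP L'' hL''P hbL).mp h1)
  -- (F6) conclusion at `L₀ = sideLength ρ (m+1)`
  obtain ⟨δg, hδg, hG⟩ := hgood0
  refine ⟨δg, hδg, fun Ψ hΨ => ?_⟩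
  have hhi : ENNReal.ofReal τ₂ ≤ hiMass m L₀ (1 / 8) Ψ.ψ :=
    ENNReal.ofReal_le_of_le_toReal (hG Ψ hΨ).le
  calc ENNReal.ofReal ((7 / 8) * τ₂ / 2 * ((m + 1 : ℕ) : ℝ))
      ≤ ENNReal.ofReal ((1 - 1 / 8) * (m + 1)) * ENNReal.ofReal τ₂ := by
        rw [← ENNReal.ofReal_mul (by positivity)]
        refine ENNReal.ofReal_le_ofReal ?_
        push_cast
        nlinarith
    _ ≤ ENNReal.ofReal ((1 - 1 / 8) * (m + 1)) * hiMass m L₀ (1 / 8) Ψ.ψ := by gcongr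
    _ ≤ condensateOccupation (m + 1) L₀ Ψ.ψ := hi_mul_le_mean hC hL₀ Ψ (1 / 8)

end Summit.AtomisticToContinuum.BoseEinsteinCondensation.Cruxes.GDTransfer.Seeded

end
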